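import Literature.AlgebraicGeometry.Motives.AbelianVarietyEquivariantQuasiSection
import Literature.AlgebraicGeometry.Motives.AbelianVarietyEquivariantSimpleFactorsUniqueFiniteGroup
import HarnessLib

/-!
# Schur's lemma with operators and uniqueness of the `R`-simple pieces over a PERFECT field

`Motives/AbelianVarietyKernelComponentAction` and `…EquivariantSimpleFactorsUnique(FiniteGroup)`
prove, over an ALGEBRAICALLY CLOSED field, that a non-zero equivariant homomorphism between
`R`-simple abelian varieties is an isogeny (through the `R`-stable identity component of the
kernel) and deduce the uniqueness of the `R`-simple pieces.  Over a PERFECT field (number fields,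
the setting of complex multiplication "over the reflex field") the kernel component is not
available in the tree, but for the actions that matter — a finite group, or a commutative ring
generated up to isogeny by one element (an order of a CM field, `𝓞_K`) — the equivariant
quasi-SECTIONS of `Motives/AbelianVarietyEquivariantQuasiSection` replace it: a non-zero
equivariant `f : S ⟶ B` into an `R`-simple `B` is surjective
(`surjective_of_simpleFor`), an equivariant quasi-section `t̃ ≫ f = M • 𝟙 B` is a NON-ZERO
equivariant homomorphism back, and `isIsogeny_of_simpleFor_of_ne_zero_of_ne_zero` concludes.

* `AbelianVariety.isIsogeny_of_simpleFor_of_generator`, `…_of_ringOfIntegers`, `…_of_fintype`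
  — **Schur's lemma with operators over a perfect field**: a non-zero equivariant homomorphism
  between `R`-simple (resp. `𝓞_K`-simple, `G`-simple) abelian varieties is an isogeny;
* `AbelianVariety.card_equivariantlyIsogenous_eq_of_simpleFor_of_generator`,
  `AbelianVariety.exists_equivariantlyIsogenous_piece_of_simpleFor_of_generator` and the
  `𝓞_K`-forms `…_of_ringOfIntegers` — **over a perfect field the `R`-simple pieces of an abelian
  variety with such an action are unique up to equivariant isogeny, with their multiplicities**
  (`Motives/AbelianVarietyEquivariantHomCount` with Schur supplied by the above); with the
  existence theorems `exists_equivariant_quasiDecomposition_of_generator` /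
  `…_of_ringOfIntegers` this is the Krull–Schmidt theorem for abelian varieties with complex
  multiplication over number fields.

Everything is proved; no definition, no named fact (D-0026).

## References

* J. S. Milne, *Abelian Varieties*, in Cornell–Silverman (eds.), *Arithmetic Geometry* (1986), §12
  p. 122 (held copy `book:cornellnd-arithmetic-geometry`, PDF p. 189). [Milne1986AbelianVarieties]
* D. Mumford, *Abelian Varieties* (1970), §19 Thm. 1, Cor. 1–2 (pp. 173–174), Remark p. 169.
  [MumfordAV1970]
* H. Lange, R. E. Rodríguez, *Decomposition of Jacobians by Prym Varieties*, LNM 2310 (2022),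
  §2.9. [LangeRodriguez2022]
-/

noncomputable section

universe u v

open CategoryTheory CategoryTheory.Limits AlgebraicGeometry Polynomial
open scoped Polynomial NumberField

namespace Literature.AlgebraicGeometry.Motives

namespace AbelianVariety

variable {K : Type u} [Field K] [PerfectField K]

/-! ## §1 Schur's lemma with operators over a perfect field -/

section Schur

variable {S B : AbelianVariety K}

omit [PerfectField K] in
/-- A quasi-section of a non-zero homomorphism is non-zero (`t ≫ f = M • 𝟙 B`, `M ≠ 0`, and
`Hom` is torsion-free). [cite: MumfordAV1970, §19 Thm. 3 and Remark p. 169] -/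
private theorem ne_zero_of_quasiSection {f : S ⟶ B} {t : B ⟶ S} {M : ℕ} (hM : M ≠ 0)
    (htf : t ≫ f = M • 𝟙 B) (hf0 : f ≠ 0) : t ≠ 0 := by
  intro h0
  rw [h0, Limits.zero_comp] at htf
  have h1 : 𝟙 B = 0 := hom_eq_zero_of_nsmul_eq_zero hM htf.symm
  exact hf0 (by rw [← Category.comp_id f, h1, Limits.comp_zero])

/-- **Schur's lemma with operators over a perfect field — commutative ring generated up to
isogeny by one element.** For actions `φ : R →+* End S`, `ψ : R →+* End B` of a commutative
ring with `α`, `p(α) = 0`, `c_u p + c_v p' = D ≠ 0`, `m r ∈ ℤ[α]` (an order of a CM field), a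
non-zero equivariant `f : S ⟶ B` between `R`-SIMPLE abelian varieties over a perfect field is an
isogeny: it is surjective (`surjective_of_simpleFor`) and an equivariant quasi-section
(`exists_equivariant_quasiSection_of_perfectField_of_generator`) is a non-zero equivariant
homomorphism back. [cite: MumfordAV1970, §19 Cor. 2 of Thm. 1] [cite: LangeRodriguez2022, §2.9] -/
theorem isIsogeny_of_simpleFor_of_generator {R : Type v} [CommRing R] (φ : R →+* End S)
    (ψ : R →+* End B) (f : S ⟶ B) (hf : ∀ r : R, End.asHom (φ r) ≫ f = f ≫ End.asHom (ψ r))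
    (hS : ∀ (W : AbelianVariety K) (ω : R →+* End W) (w : W ⟶ S),
      IsClosedImmersion (Hom.toSchemeHom w) →
      (∀ r : R, w ≫ End.asHom (φ r) = End.asHom (ω r) ≫ w) → 0 < W.dim → W.dim < S.dim → False)
    (hB : ∀ (W : AbelianVariety K) (ω : R →+* End W) (w : W ⟶ B),
      IsClosedImmersion (Hom.toSchemeHom w) →
      (∀ r : R, w ≫ End.asHom (ψ r) = End.asHom (ω r) ≫ w) → 0 < W.dim → W.dim < B.dim → False)
    (α : R) (p cu cv : Polynomial ℤ) (D : ℤ) (hD : D ≠ 0) (hp : aeval α p = 0)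
    (hcert : cu * p + cv * derivative p = C D)
    (hgen : ∀ r : R, ∃ (m : ℕ) (q : Polynomial ℤ), m ≠ 0 ∧ (m : R) * r = aeval α q)
    (hf0 : f ≠ 0) : IsIsogeny f := by
  haveI := surjective_of_simpleFor φ ψ f hf hB hf0
  obtain ⟨t, M, hM, htf, hte⟩ := exists_equivariant_quasiSection_of_perfectField_of_generator
    φ ψ f hf α p cu cv D hD hp hcert hgen
  exact isIsogeny_of_simpleFor_of_ne_zero_of_ne_zero φ ψ f hf hS hB hf0 hte
    (ne_zero_of_quasiSection hM htf hf0)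

/-- **Schur's lemma with operators over a perfect field — complex multiplication by `𝓞_K`**:
a non-zero `𝓞_K`-equivariant homomorphism between `𝓞_K`-simple abelian varieties over a perfect
field is an isogeny. [cite: MumfordAV1970, §19 Cor. 2 of Thm. 1] [cite: LangeRodriguez2022, §2.9] -/
theorem isIsogeny_of_simpleFor_of_ringOfIntegers {L : Type*} [Field L] [NumberField L]
    (φ : 𝓞 L →+* End S) (ψ : 𝓞 L →+* End B) (f : S ⟶ B)
    (hf : ∀ r : 𝓞 L, End.asHom (φ r) ≫ f = f ≫ End.asHom (ψ r))
    (hS : ∀ (W : AbelianVariety K) (ω : 𝓞 L →+* End W) (w : W ⟶ S),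
      IsClosedImmersion (Hom.toSchemeHom w) →
      (∀ r : 𝓞 L, w ≫ End.asHom (φ r) = End.asHom (ω r) ≫ w) → 0 < W.dim → W.dim < S.dim →
      False)
    (hB : ∀ (W : AbelianVariety K) (ω : 𝓞 L →+* End W) (w : W ⟶ B),
      IsClosedImmersion (Hom.toSchemeHom w) →
      (∀ r : 𝓞 L, w ≫ End.asHom (ψ r) = End.asHom (ω r) ≫ w) → 0 < W.dim → W.dim < B.dim →
      False)
    (hf0 : f ≠ 0) : IsIsogeny f := by
  obtain ⟨α, p, cu, cv, D, hD, hp, hcert, hgen⟩ :=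
    NumberField.RingOfIntegers.exists_generator_certificate L
  exact isIsogeny_of_simpleFor_of_generator φ ψ f hf hS hB α p cu cv D hD hp hcert hgen hf0

/-- **Schur's lemma with operators over a perfect field — finite group**: a non-zero
`G`-equivariant homomorphism between `G`-simple abelian varieties over a perfect field is an
isogeny (through the group ring `ℤ[G]`: `G`-simple is `ℤ[G]`-simple and the Maschke-averaged
quasi-section is `ℤ[G]`-equivariant). [cite: LangeRodriguez2022, Thm. 2.7.1 and §2.9]
[cite: MumfordAV1970, §19 Cor. 2 of Thm. 1] -/
theorem isIsogeny_of_simpleFor_of_fintype {G : Type v} [Group G] [Fintype G] (ρ : G →* End S)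
    (ρ' : G →* End B) (f : S ⟶ B) (hf : ∀ g : G, End.asHom (ρ g) ≫ f = f ≫ End.asHom (ρ' g))
    (hS : ∀ (W : AbelianVariety K) (ω : G →* End W) (w : W ⟶ S),
      IsClosedImmersion (Hom.toSchemeHom w) →
      (∀ g : G, w ≫ End.asHom (ρ g) = End.asHom (ω g) ≫ w) → 0 < W.dim → W.dim < S.dim → False)
    (hB : ∀ (W : AbelianVariety K) (ω : G →* End W) (w : W ⟶ B),
      IsClosedImmersion (Hom.toSchemeHom w) →
      (∀ g : G, w ≫ End.asHom (ρ' g) = End.asHom (ω g) ≫ w) → 0 < W.dim → W.dim < B.dim → False)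
    (hf0 : f ≠ 0) : IsIsogeny f := by
  -- through the group ring
  let ZG := MonoidAlgebra ℤ G
  let res : ∀ {A : AbelianVariety K}, (ZG →+* End A) → (G →* End A) :=
    fun φ ↦ (φ : ZG →* End _).comp (MonoidAlgebra.of ℤ G)
  let ext : ∀ {A : AbelianVariety K}, (G →* End A) → (ZG →+* End A) :=
    fun ρ ↦ (MonoidAlgebra.lift ℤ (End _) G ρ).toRingHom
  have ext_of : ∀ {A : AbelianVariety K} (ρ : G →* End A) (g : G),
      ext ρ (MonoidAlgebra.of ℤ G g) = ρ g := fun ρ g ↦ by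
    change MonoidAlgebra.lift ℤ (End _) G ρ (MonoidAlgebra.of ℤ G g) = ρ g
    exact MonoidAlgebra.lift_of ρ g
  have hin : ∀ {A A' : AbelianVariety K} (a : G →* End A) (b : G →* End A') (h : A ⟶ A'),
      (∀ g : G, h ≫ End.asHom (b g) = End.asHom (a g) ≫ h) →
      ∀ x : ZG, h ≫ End.asHom (ext b x) = End.asHom (ext a x) ≫ h :=
    fun a b h hh ↦ comp_eq_comp_monoidAlgebra_of_forall (ext a) (ext b) h fun g ↦ by
      rw [ext_of, ext_of]; exact hh g
  have hsimple : ∀ {A : AbelianVariety K} (a : G →* End A),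
      (∀ (W : AbelianVariety K) (ω : G →* End W) (w : W ⟶ A),
        IsClosedImmersion (Hom.toSchemeHom w) →
        (∀ g : G, w ≫ End.asHom (a g) = End.asHom (ω g) ≫ w) → 0 < W.dim → W.dim < A.dim →
        False) →
      ∀ (W : AbelianVariety K) (ω : ZG →+* End W) (w : W ⟶ A),
        IsClosedImmersion (Hom.toSchemeHom w) →
        (∀ x : ZG, w ≫ End.asHom (ext a x) = End.asHom (ω x) ≫ w) → 0 < W.dim → W.dim < A.dim →
        False :=
    fun a ha W ω w hw hwe h0 hlt ↦ ha W (res ω) w hw (fun g ↦ by rw [← ext_of a g]; exact hwe _)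
      h0 hlt
  have hf' : ∀ x : ZG, End.asHom (ext ρ x) ≫ f = f ≫ End.asHom (ext ρ' x) :=
    fun x ↦ (hin ρ ρ' f (fun g ↦ (hf g).symm) x).symm
  haveI := surjective_of_simpleFor (ext ρ) (ext ρ') f hf' (hsimple ρ' hB) hf0
  obtain ⟨t, M, hM, htf, hte⟩ := exists_equivariant_quasiSection_of_perfectField_of_fintype ρ ρ' f hf
  exact isIsogeny_of_simpleFor_of_ne_zero_of_ne_zero (ext ρ) (ext ρ') f hf' (hsimple ρ hS)
    (hsimple ρ' hB) hf0 (g := t) (fun x ↦ (hin ρ' ρ t (fun g ↦ (hte g).symm) x).symm)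
    (ne_zero_of_quasiSection hM htf hf0)

end Schur

/-! ## §2 Uniqueness of the `R`-simple pieces over a perfect field -/

section Unique

variable {X : AbelianVariety K} {I : Type} [Fintype I] {S : I → AbelianVariety K}
  (ι : ∀ i, S i ⟶ X) (π : ∀ i, X ⟶ S i) {N : ℕ}

/-- **The multiplicities of the `R`-simple pieces are uniquely determined over a perfect field —
commutative ring generated up to isogeny by one element** (an order of a CM field): for
equivariant decompositions up to isogeny `X ~ ⊕ Sᵢ` of `(X, φ)` and `X' ~ ⊕ Tⱼ` of `(X', φ')`
into `R`-SIMPLE pieces linked by an equivariant isogeny `u : X ⟶ X'`, and an `R`-simple `(B, β)`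
of positive dimension, `#{i : Sᵢ ∼_R B} = #{j : Tⱼ ∼_R B}`
(`card_equivariantlyIsogenous_eq_of_quasiDecompositions` with Schur
`isIsogeny_of_simpleFor_of_generator`). [cite: Milne1986AbelianVarieties, §12 p. 122 (PDF p. 189)]
[cite: LangeRodriguez2022, §2.9] -/
theorem card_equivariantlyIsogenous_eq_of_simpleFor_of_generator {R : Type v} [CommRing R]
    (α : R) (p cu cv : Polynomial ℤ) (D : ℤ) (hD : D ≠ 0) (hp : aeval α p = 0)
    (hcert : cu * p + cv * derivative p = C D)
    (hgen : ∀ r : R, ∃ (m : ℕ) (q : Polynomial ℤ), m ≠ 0 ∧ (m : R) * r = aeval α q)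
    (φ : R →+* End X) (χ : ∀ i, R →+* End (S i))
    (hS : ∀ i, ∀ (W : AbelianVariety K) (ω : R →+* End W) (w : W ⟶ S i),
      IsClosedImmersion (Hom.toSchemeHom w) →
      (∀ r : R, w ≫ End.asHom (χ i r) = End.asHom (ω r) ≫ w) →
      0 < W.dim → W.dim < (S i).dim → False)
    (hN : 0 < N) (h1 : ∀ i, ι i ≫ π i = N • 𝟙 (S i)) (h2 : ∀ i j, i ≠ j → ι i ≫ π j = 0)
    (h3 : ∑ i, π i ≫ ι i = N • 𝟙 X)
    (hι : ∀ i (r : R), ι i ≫ End.asHom (φ r) = End.asHom (χ i r) ≫ ι i)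
    (hπ : ∀ i (r : R), End.asHom (φ r) ≫ π i = π i ≫ End.asHom (χ i r))
    {X' : AbelianVariety K} (φ' : R →+* End X') {J : Type} [Fintype J]
    {T : J → AbelianVariety K} (τ : ∀ j, R →+* End (T j))
    (hT : ∀ j, ∀ (W : AbelianVariety K) (ω : R →+* End W) (w : W ⟶ T j),
      IsClosedImmersion (Hom.toSchemeHom w) →
      (∀ r : R, w ≫ End.asHom (τ j r) = End.asHom (ω r) ≫ w) →
      0 < W.dim → W.dim < (T j).dim → False)
    (ι' : ∀ j, T j ⟶ X') (π' : ∀ j, X' ⟶ T j) {N' : ℕ} (hN' : 0 < N')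
    (h1' : ∀ j, ι' j ≫ π' j = N' • 𝟙 (T j)) (h2' : ∀ j j', j ≠ j' → ι' j ≫ π' j' = 0)
    (h3' : ∑ j, π' j ≫ ι' j = N' • 𝟙 X')
    (hι' : ∀ j (r : R), ι' j ≫ End.asHom (φ' r) = End.asHom (τ j r) ≫ ι' j)
    (hπ' : ∀ j (r : R), End.asHom (φ' r) ≫ π' j = π' j ≫ End.asHom (τ j r))
    {u : X ⟶ X'} (hu : IsIsogeny u) (hue : ∀ r : R, End.asHom (φ r) ≫ u = u ≫ End.asHom (φ' r))
    {B : AbelianVariety K} (β : R →+* End B) (hB : 0 < B.dim)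
    (hBs : ∀ (W : AbelianVariety K) (ω : R →+* End W) (w : W ⟶ B),
      IsClosedImmersion (Hom.toSchemeHom w) →
      (∀ r : R, w ≫ End.asHom (β r) = End.asHom (ω r) ≫ w) → 0 < W.dim → W.dim < B.dim → False) :
    Nat.card {i // ∃ v : S i ⟶ B, IsIsogeny v ∧
        ∀ r : R, End.asHom (χ i r) ≫ v = v ≫ End.asHom (β r)} =
      Nat.card {j // ∃ v : T j ⟶ B, IsIsogeny v ∧
        ∀ r : R, End.asHom (τ j r) ≫ v = v ≫ End.asHom (β r)} :=
  card_equivariantlyIsogenous_eq_of_quasiDecompositions ι π φ χ hN h1 h2 h3 hι hπ φ' τ ι' π' hN'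
    h1' h2' h3' hι' hπ' hu hue β hB
    (fun i f hf hf0 ↦ isIsogeny_of_simpleFor_of_generator (χ i) β f hf (hS i) hBs α p cu cv D hD
      hp hcert hgen hf0)
    (fun j f hf hf0 ↦ isIsogeny_of_simpleFor_of_generator (τ j) β f hf (hT j) hBs α p cu cv D hD
      hp hcert hgen hf0)

/-- **Each `R`-simple piece is determined up to equivariant isogeny over a perfect field —
commutative ring generated up to isogeny by one element**: in the situation of
`card_equivariantlyIsogenous_eq_of_simpleFor_of_generator`, every piece `S_{i₀}` of positive
dimension receives an equivariant isogeny from some `Tⱼ`.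
[cite: Milne1986AbelianVarieties, §12 p. 122 (PDF p. 189)] [cite: LangeRodriguez2022, §2.9] -/
theorem exists_equivariantlyIsogenous_piece_of_simpleFor_of_generator {R : Type v} [CommRing R]
    (α : R) (p cu cv : Polynomial ℤ) (D : ℤ) (hD : D ≠ 0) (hp : aeval α p = 0)
    (hcert : cu * p + cv * derivative p = C D)
    (hgen : ∀ r : R, ∃ (m : ℕ) (q : Polynomial ℤ), m ≠ 0 ∧ (m : R) * r = aeval α q)
    (φ : R →+* End X) (χ : ∀ i, R →+* End (S i))
    (hS : ∀ i, ∀ (W : AbelianVariety K) (ω : R →+* End W) (w : W ⟶ S i),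
      IsClosedImmersion (Hom.toSchemeHom w) →
      (∀ r : R, w ≫ End.asHom (χ i r) = End.asHom (ω r) ≫ w) →
      0 < W.dim → W.dim < (S i).dim → False)
    (hN : 0 < N) (h1 : ∀ i, ι i ≫ π i = N • 𝟙 (S i)) (h2 : ∀ i j, i ≠ j → ι i ≫ π j = 0)
    (h3 : ∑ i, π i ≫ ι i = N • 𝟙 X)
    (hι : ∀ i (r : R), ι i ≫ End.asHom (φ r) = End.asHom (χ i r) ≫ ι i)
    (hπ : ∀ i (r : R), End.asHom (φ r) ≫ π i = π i ≫ End.asHom (χ i r))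
    {X' : AbelianVariety K} (φ' : R →+* End X') {J : Type} [Fintype J]
    {T : J → AbelianVariety K} (τ : ∀ j, R →+* End (T j))
    (hT : ∀ j, ∀ (W : AbelianVariety K) (ω : R →+* End W) (w : W ⟶ T j),
      IsClosedImmersion (Hom.toSchemeHom w) →
      (∀ r : R, w ≫ End.asHom (τ j r) = End.asHom (ω r) ≫ w) →
      0 < W.dim → W.dim < (T j).dim → False)
    (ι' : ∀ j, T j ⟶ X') (π' : ∀ j, X' ⟶ T j) {N' : ℕ} (hN' : 0 < N')
    (h1' : ∀ j, ι' j ≫ π' j = N' • 𝟙 (T j)) (h2' : ∀ j j', j ≠ j' → ι' j ≫ π' j' = 0)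
    (h3' : ∑ j, π' j ≫ ι' j = N' • 𝟙 X')
    (hι' : ∀ j (r : R), ι' j ≫ End.asHom (φ' r) = End.asHom (τ j r) ≫ ι' j)
    (hπ' : ∀ j (r : R), End.asHom (φ' r) ≫ π' j = π' j ≫ End.asHom (τ j r))
    {u : X ⟶ X'} (hu : IsIsogeny u) (hue : ∀ r : R, End.asHom (φ r) ≫ u = u ≫ End.asHom (φ' r))
    (i₀ : I) (hi₀ : 0 < (S i₀).dim) :
    ∃ (j : J) (v : T j ⟶ S i₀), IsIsogeny v ∧
      ∀ r : R, End.asHom (τ j r) ≫ v = v ≫ End.asHom (χ i₀ r) :=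
  exists_equivariantlyIsogenous_piece_of_quasiDecompositions ι π φ χ hN h1 h2 h3 hι hπ φ' τ ι' π'
    hN' h1' h2' h3' hι' hπ' hu hue i₀ hi₀
    (fun i f hf hf0 ↦ isIsogeny_of_simpleFor_of_generator (χ i) (χ i₀) f hf (hS i) (hS i₀) α p cu
      cv D hD hp hcert hgen hf0)
    (fun j f hf hf0 ↦ isIsogeny_of_simpleFor_of_generator (τ j) (χ i₀) f hf (hT j) (hS i₀) α p cu
      cv D hD hp hcert hgen hf0)

/-- **The multiplicities of the `𝓞_K`-simple pieces are uniquely determined over a perfect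
field**: for `𝓞_K`-equivariant decompositions up to isogeny of `𝓞_K`-equivariantly isogenous
abelian varieties into `𝓞_K`-SIMPLE pieces and an `𝓞_K`-simple `(B, β)` of positive dimension,
`#{i : Sᵢ ∼_{𝓞_K} B} = #{j : Tⱼ ∼_{𝓞_K} B}` — the arithmetic case (abelian varieties with complex
multiplication over a number field) of Krull–Schmidt with operators.
[cite: Milne1986AbelianVarieties, §12 p. 122 (PDF p. 189)] [cite: MumfordAV1970, §19 Cor. 1 of Thm. 1 (p. 173)] -/
theorem card_equivariantlyIsogenous_eq_of_simpleFor_of_ringOfIntegers {L : Type*} [Field L]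
    [NumberField L] (φ : 𝓞 L →+* End X) (χ : ∀ i, 𝓞 L →+* End (S i))
    (hS : ∀ i, ∀ (W : AbelianVariety K) (ω : 𝓞 L →+* End W) (w : W ⟶ S i),
      IsClosedImmersion (Hom.toSchemeHom w) →
      (∀ r : 𝓞 L, w ≫ End.asHom (χ i r) = End.asHom (ω r) ≫ w) →
      0 < W.dim → W.dim < (S i).dim → False)
    (hN : 0 < N) (h1 : ∀ i, ι i ≫ π i = N • 𝟙 (S i)) (h2 : ∀ i j, i ≠ j → ι i ≫ π j = 0)
    (h3 : ∑ i, π i ≫ ι i = N • 𝟙 X)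
    (hι : ∀ i (r : 𝓞 L), ι i ≫ End.asHom (φ r) = End.asHom (χ i r) ≫ ι i)
    (hπ : ∀ i (r : 𝓞 L), End.asHom (φ r) ≫ π i = π i ≫ End.asHom (χ i r))
    {X' : AbelianVariety K} (φ' : 𝓞 L →+* End X') {J : Type} [Fintype J]
    {T : J → AbelianVariety K} (τ : ∀ j, 𝓞 L →+* End (T j))
    (hT : ∀ j, ∀ (W : AbelianVariety K) (ω : 𝓞 L →+* End W) (w : W ⟶ T j),
      IsClosedImmersion (Hom.toSchemeHom w) →
      (∀ r : 𝓞 L, w ≫ End.asHom (τ j r) = End.asHom (ω r) ≫ w) →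
      0 < W.dim → W.dim < (T j).dim → False)
    (ι' : ∀ j, T j ⟶ X') (π' : ∀ j, X' ⟶ T j) {N' : ℕ} (hN' : 0 < N')
    (h1' : ∀ j, ι' j ≫ π' j = N' • 𝟙 (T j)) (h2' : ∀ j j', j ≠ j' → ι' j ≫ π' j' = 0)
    (h3' : ∑ j, π' j ≫ ι' j = N' • 𝟙 X')
    (hι' : ∀ j (r : 𝓞 L), ι' j ≫ End.asHom (φ' r) = End.asHom (τ j r) ≫ ι' j)
    (hπ' : ∀ j (r : 𝓞 L), End.asHom (φ' r) ≫ π' j = π' j ≫ End.asHom (τ j r))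
    {u : X ⟶ X'} (hu : IsIsogeny u)
    (hue : ∀ r : 𝓞 L, End.asHom (φ r) ≫ u = u ≫ End.asHom (φ' r))
    {B : AbelianVariety K} (β : 𝓞 L →+* End B) (hB : 0 < B.dim)
    (hBs : ∀ (W : AbelianVariety K) (ω : 𝓞 L →+* End W) (w : W ⟶ B),
      IsClosedImmersion (Hom.toSchemeHom w) →
      (∀ r : 𝓞 L, w ≫ End.asHom (β r) = End.asHom (ω r) ≫ w) → 0 < W.dim → W.dim < B.dim →
      False) :
    Nat.card {i // ∃ v : S i ⟶ B, IsIsogeny v ∧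
        ∀ r : 𝓞 L, End.asHom (χ i r) ≫ v = v ≫ End.asHom (β r)} =
      Nat.card {j // ∃ v : T j ⟶ B, IsIsogeny v ∧
        ∀ r : 𝓞 L, End.asHom (τ j r) ≫ v = v ≫ End.asHom (β r)} := by
  obtain ⟨α, p, cu, cv, D, hD, hp, hcert, hgen⟩ :=
    NumberField.RingOfIntegers.exists_generator_certificate L
  exact card_equivariantlyIsogenous_eq_of_simpleFor_of_generator ι π α p cu cv D hD hp hcert hgen φ
    χ hS hN h1 h2 h3 hι hπ φ' τ hT ι' π' hN' h1' h2' h3' hι' hπ' hu hue β hB hBs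

/-- **Each `𝓞_K`-simple piece is determined up to `𝓞_K`-equivariant isogeny over a perfect
field**: every `𝓞_K`-simple piece of positive dimension of one decomposition receives an
`𝓞_K`-equivariant isogeny from a piece of the other.
[cite: Milne1986AbelianVarieties, §12 p. 122 (PDF p. 189)] [cite: MumfordAV1970, §19 Cor. 1 of Thm. 1 (p. 173)] -/
theorem exists_equivariantlyIsogenous_piece_of_simpleFor_of_ringOfIntegers {L : Type*} [Field L]
    [NumberField L] (φ : 𝓞 L →+* End X) (χ : ∀ i, 𝓞 L →+* End (S i))
    (hS : ∀ i, ∀ (W : AbelianVariety K) (ω : 𝓞 L →+* End W) (w : W ⟶ S i),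
      IsClosedImmersion (Hom.toSchemeHom w) →
      (∀ r : 𝓞 L, w ≫ End.asHom (χ i r) = End.asHom (ω r) ≫ w) →
      0 < W.dim → W.dim < (S i).dim → False)
    (hN : 0 < N) (h1 : ∀ i, ι i ≫ π i = N • 𝟙 (S i)) (h2 : ∀ i j, i ≠ j → ι i ≫ π j = 0)
    (h3 : ∑ i, π i ≫ ι i = N • 𝟙 X)
    (hι : ∀ i (r : 𝓞 L), ι i ≫ End.asHom (φ r) = End.asHom (χ i r) ≫ ι i)
    (hπ : ∀ i (r : 𝓞 L), End.asHom (φ r) ≫ π i = π i ≫ End.asHom (χ i r))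
    {X' : AbelianVariety K} (φ' : 𝓞 L →+* End X') {J : Type} [Fintype J]
    {T : J → AbelianVariety K} (τ : ∀ j, 𝓞 L →+* End (T j))
    (hT : ∀ j, ∀ (W : AbelianVariety K) (ω : 𝓞 L →+* End W) (w : W ⟶ T j),
      IsClosedImmersion (Hom.toSchemeHom w) →
      (∀ r : 𝓞 L, w ≫ End.asHom (τ j r) = End.asHom (ω r) ≫ w) →
      0 < W.dim → W.dim < (T j).dim → False)
    (ι' : ∀ j, T j ⟶ X') (π' : ∀ j, X' ⟶ T j) {N' : ℕ} (hN' : 0 < N')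
    (h1' : ∀ j, ι' j ≫ π' j = N' • 𝟙 (T j)) (h2' : ∀ j j', j ≠ j' → ι' j ≫ π' j' = 0)
    (h3' : ∑ j, π' j ≫ ι' j = N' • 𝟙 X')
    (hι' : ∀ j (r : 𝓞 L), ι' j ≫ End.asHom (φ' r) = End.asHom (τ j r) ≫ ι' j)
    (hπ' : ∀ j (r : 𝓞 L), End.asHom (φ' r) ≫ π' j = π' j ≫ End.asHom (τ j r))
    {u : X ⟶ X'} (hu : IsIsogeny u)
    (hue : ∀ r : 𝓞 L, End.asHom (φ r) ≫ u = u ≫ End.asHom (φ' r))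
    (i₀ : I) (hi₀ : 0 < (S i₀).dim) :
    ∃ (j : J) (v : T j ⟶ S i₀), IsIsogeny v ∧
      ∀ r : 𝓞 L, End.asHom (τ j r) ≫ v = v ≫ End.asHom (χ i₀ r) := by
  obtain ⟨α, p, cu, cv, D, hD, hp, hcert, hgen⟩ :=
    NumberField.RingOfIntegers.exists_generator_certificate L
  exact exists_equivariantlyIsogenous_piece_of_simpleFor_of_generator ι π α p cu cv D hD hp hcert
    hgen φ χ hS hN h1 h2 h3 hι hπ φ' τ hT ι' π' hN' h1' h2' h3' hι' hπ' hu hue i₀ hi₀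

end Unique

end AbelianVariety

end Literature.AlgebraicGeometry.Motives

end
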